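import Summits.QuantumFields.BalabanUV.Beta.FP.TowerK2bDoorGapTelescope

/-!
# `BalabanUV.Beta.FP.TowerK2bDoorGapTadpole` — binder row D1 ∕ (C1) OWNER «beta-an2», PART 39: **THE DOOR TADPOLE IN CLOSED FORM** — the trace of a door gap against
# any table `A` is the brick paired with the `K`-twisted transport of `A` (`tr(A·gap) = tr(H·(L̂AKᵀ − KAL̂ᵀ))`); it VANISHES IDENTICALLY for a symmetric brick and a symmetric
# `A`, equals `2·tr(H·L̂·A·Kᵀ)` for an ANTISYMMETRIC brick (the record's `symHessKerAt`, `symHessKerAt_swap`), obeys the cyclic identity `tr(B⁻¹·[E,B]) = 0` behind the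
# propagator's Ward mechanism, and TELESCOPES with the propagator transported by the legs below each storey — the kernel vocabulary of road «FP» SPEC-64 §1 `hDΔ`, §3 (B1)∕(B2)
# and of its by-value gate G2 (the door tadpole at n = 0), over PART 38's letters VERBATIM, hypothesis-free except where displayed

WHY (road FP g50 `HOME/b2b-balaban-beta-d1-p3/g50/SPEC-64.md` v2.1 7f8875b0f2e38412, §1 (O3)∕(O4): whatever the placement, a door family fed to the tower law as N-data surfaces in the
END as ONE scalar row per step, `hDΔ : tadpole (AN ρc j) (𝒲Δ∞ j μ 0 ν z) = 0` — the door-gap family traced against the one-shot propagator; §5 G2 measures it at n = 0).  PART 38 §1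
writes the door gap as `Kᵀ·H·L̂ − L̂ᵀ·H·K` (`K := L̂·E − E′·L̂` the legs' intertwining defect); THIS FILE traces it:
§1 **`trace_mul_doorGap`** — for ANY square `A` on the fine index, `tr(A·([E, L̂ᵀHL̂] − L̂ᵀ[E′,H]L̂)) = tr(H·(L̂·A·Kᵀ − K·A·L̂ᵀ))` (cyclicity only);
§2 **`trace_mul_doorGap_eq_zero_of_symm`** — if `Hᵀ = H` and `Aᵀ = A` the door tadpole is ZERO for every `E, E′, L̂` (the twisted transport `L̂AKᵀ − KAL̂ᵀ` is antisymmetric);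
   **`trace_mul_doorGap_of_antisymm`** — if `Hᵀ = −H` and `Aᵀ = A` it is `2·tr(H·L̂·A·Kᵀ)` (the record's brick `symHessKerAt` IS antisymmetric: `SymAveragingHessianCounts.symHessKerAt_swap`;
   so G2 is a genuine test, and this is its one-term fold);
§3 **`trace_mul_commutator_eq_zero_of_inverse`** — `B·A = 1 ⇒ tr(A·(E·B − B·E)) = 0` for ANY `E` (the kernel form of SPEC-64 (B1)'s «propagator Ward identity» mechanism: a commutator
   door traced against the INVERSE of the very table it turns vanishes by cyclicity; relevant exactly insofar as the contracted table is the one the propagator inverts — not claimed);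
§4 **`trace_mul_doorGap_comp`** — THE TADPOLE TELESCOPE: `tr(A·gap(L̂₂L̂₁; E₀,E₂; H)) = tr(A·gap(L̂₁; E₀,E₁; L̂₂ᵀHL̂₂)) + tr((L̂₁·A·L̂₁ᵀ)·gap(L̂₂; E₁,E₂; H))` — the storey-2 door is traced
   against the propagator TRANSPORTED by the storey-1 legs (PART 38 §3 + cyclicity; SPEC-64 (B1) second half ∕ (B2)'s frame).
[folklore] `Matrix.trace` algebra BY NAME over abstract finite index types; no `def`, no `def … : Prop`, nothing cited, 0 sorry.  Nothing of Bałaban's asserted, valued or discharged;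
`hDΔ` NOT claimed either way (unmeasured; G2 decides by value, zero weight on any binder); (J-R₂″) NOT claimed either way; no door gap or door tadpole claimed to vanish AT THE RECORD;
0∕4 row-D1 binders (hW ∕ hR ∕ D1Tel ∕ D1Rep); NOT (C1), NOT (T-ID), NOT D1, NEVER «G-an2-4 closed», NOT BetaPertH, NOT continuum, NOT Clay.
HONEST DEPENDENCY (page 1, mandatory): continuum YM on T⁴ ⇐ BetaPertH ∧ nine spine estimates (0/9 proved); BetaPertH ⇐ (D1) ∧ (D4) ∧ CAP+tail;
G-an2-4 gates asym, D1 and NE2/3/4.  HONEST FRAMING (cell contract, verbatim): «discharging `BetaPertH` makes Bałaban's UV stability UNCONDITIONAL —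
a real constructive-QFT result; it is NOT the continuum limit and NOT the Clay problem.»  ABSOLUTE RULE (cell charter, verbatim): «No internally-minted
statement may enter as a cited fact. Every hypothesis is either kernel-proved in this package or a verbatim quotation of a PUBLISHED theorem with page
reference. The manuscript(s) under audit are NOT citable for their own disputed steps — they are the thing under adjudication; programme-internal
(2001/route/tribunal) claims are never citable.»  Row D1 ∕ (C1) OWNER, b2b-balaban-beta-an2 gen 74, 2026-08-28.  No existing file touched.
-/

noncomputable section

open scoped BigOperators

namespace Summit.QuantumFields.BalabanUV.Beta.FP.TowerK2bDoorGapTadpole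

open Finset Matrix
open Summit.QuantumFields.BalabanUV.Beta.FP.TowerK2bDoorGapTelescope (doorGap_eq_intertwiner_sandwich doorGap_comp)

variable {ι τ υ : Type*} [Fintype ι] [DecidableEq ι] [Fintype τ] [DecidableEq τ] [Fintype υ] [DecidableEq υ]

/-! ## §1 The door tadpole is the brick paired with the `K`-twisted transport of the table -/

omit [DecidableEq ι] [DecidableEq τ] [Fintype υ] [DecidableEq υ] in
/-- [folklore] cyclic bookkeeping: `tr(A·(X·Y·Z)) = tr(Y·(Z·A·X))`. -/
theorem trace_mul_mul₃_comm (A : Matrix ι ι ℝ) (X : Matrix ι τ ℝ) (Z : Matrix τ ι ℝ) (Y : Matrix τ τ ℝ) :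
    Matrix.trace (A * (X * Y * Z)) = Matrix.trace (Y * (Z * A * X)) := by
  calc Matrix.trace (A * (X * Y * Z)) = Matrix.trace ((A * X) * (Y * Z)) := by simp only [Matrix.mul_assoc]
    _ = Matrix.trace ((Y * Z) * (A * X)) := Matrix.trace_mul_comm _ _
    _ = Matrix.trace (Y * (Z * A * X)) := by simp only [Matrix.mul_assoc]

omit [Fintype υ] [DecidableEq υ] in
/-- [folklore] **`trace_mul_doorGap`**: for any `A : Matrix ι ι ℝ`, legs `L̂ : Matrix τ ι ℝ`, brick `H : Matrix τ τ ℝ`, generators `E = diagonal d`, `E′ = diagonal d′` and the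
intertwining defect `K := L̂·E − E′·L̂`:  `tr(A·(([E, L̂ᵀHL̂]) − L̂ᵀ[E′,H]L̂)) = tr(H·(L̂·A·Kᵀ − K·A·L̂ᵀ))`. -/
theorem trace_mul_doorGap (A : Matrix ι ι ℝ) (d : ι → ℝ) (d' : τ → ℝ) (L : Matrix τ ι ℝ) (H : Matrix τ τ ℝ) :
    Matrix.trace (A * ((Matrix.diagonal d * (Lᵀ * H * L) - (Lᵀ * H * L) * Matrix.diagonal d) - Lᵀ * (Matrix.diagonal d' * H - H * Matrix.diagonal d') * L))
      = Matrix.trace (H * (L * A * (L * Matrix.diagonal d - Matrix.diagonal d' * L)ᵀ - (L * Matrix.diagonal d - Matrix.diagonal d' * L) * A * Lᵀ)) := by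
  rw [doorGap_eq_intertwiner_sandwich]
  generalize L * Matrix.diagonal d - Matrix.diagonal d' * L = K
  rw [Matrix.mul_sub, Matrix.trace_sub, Matrix.mul_sub, Matrix.trace_sub, trace_mul_mul₃_comm A Kᵀ L H, trace_mul_mul₃_comm A Lᵀ K H]

/-! ## §2 Symmetric bricks have no door tadpole; antisymmetric bricks have `2·tr(H·L̂·A·Kᵀ)` -/

omit [DecidableEq τ] [Fintype υ] [DecidableEq υ] in
/-- [folklore] the trace of a symmetric table against an antisymmetrised one vanishes: `Hᵀ = H ⇒ tr(H·(M − Mᵀ)) = 0`. -/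
theorem trace_mul_sub_transpose_eq_zero_of_symm (H M : Matrix τ τ ℝ) (hH : Hᵀ = H) : Matrix.trace (H * (M - Mᵀ)) = 0 := by
  rw [Matrix.mul_sub, Matrix.trace_sub, sub_eq_zero, ← Matrix.trace_transpose (H * Mᵀ), Matrix.transpose_mul, Matrix.transpose_transpose, hH,
    Matrix.trace_mul_comm]

omit [DecidableEq τ] [Fintype υ] [DecidableEq υ] in
/-- [folklore] the trace of an antisymmetric table against an antisymmetrised one doubles: `Hᵀ = −H ⇒ tr(H·(M − Mᵀ)) = 2·tr(H·M)`. -/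
theorem trace_mul_sub_transpose_of_antisymm (H M : Matrix τ τ ℝ) (hH : Hᵀ = -H) : Matrix.trace (H * (M - Mᵀ)) = 2 * Matrix.trace (H * M) := by
  rw [Matrix.mul_sub, Matrix.trace_sub, ← Matrix.trace_transpose (H * Mᵀ), Matrix.transpose_mul, Matrix.transpose_transpose, hH, Matrix.mul_neg,
    Matrix.trace_neg, Matrix.trace_mul_comm]
  ring

omit [Fintype υ] [DecidableEq υ] in
/-- [folklore] **`trace_mul_doorGap_eq_zero_of_symm` — A SYMMETRIC BRICK HAS NO DOOR TADPOLE against a symmetric table**: `Hᵀ = H`, `Aᵀ = A` ⇒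
`tr(A·([E, L̂ᵀHL̂] − L̂ᵀ[E′,H]L̂)) = 0` for every `E = diagonal d`, `E′ = diagonal d′`, `L̂` (the `K`-twisted transport `L̂AKᵀ − KAL̂ᵀ` is antisymmetric). -/
theorem trace_mul_doorGap_eq_zero_of_symm (A : Matrix ι ι ℝ) (hA : Aᵀ = A) (d : ι → ℝ) (d' : τ → ℝ) (L : Matrix τ ι ℝ) (H : Matrix τ τ ℝ) (hH : Hᵀ = H) :
    Matrix.trace (A * ((Matrix.diagonal d * (Lᵀ * H * L) - (Lᵀ * H * L) * Matrix.diagonal d) - Lᵀ * (Matrix.diagonal d' * H - H * Matrix.diagonal d') * L)) = 0 := by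
  rw [trace_mul_doorGap]
  have hT : ((L * Matrix.diagonal d - Matrix.diagonal d' * L) * A * Lᵀ) = (L * A * (L * Matrix.diagonal d - Matrix.diagonal d' * L)ᵀ)ᵀ := by
    rw [Matrix.transpose_mul, Matrix.transpose_mul, Matrix.transpose_transpose, hA, Matrix.mul_assoc]
  rw [hT]
  exact trace_mul_sub_transpose_eq_zero_of_symm H _ hH

omit [Fintype υ] [DecidableEq υ] in
/-- [folklore] **`trace_mul_doorGap_of_antisymm` — AN ANTISYMMETRIC BRICK's DOOR TADPOLE** against a symmetric table: `Hᵀ = −H`, `Aᵀ = A` ⇒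
`tr(A·([E, L̂ᵀHL̂] − L̂ᵀ[E′,H]L̂)) = 2·tr(H·L̂·A·Kᵀ)`, `K := L̂·E − E′·L̂` — ONE term: the brick paired with the transport of `A` by one leg and one intertwining defect
(the record's brick `symHessKerAt` is antisymmetric — `symHessKerAt_swap` — so this is the one-term fold of SPEC-64's gate G2; nothing claimed about its value). -/
theorem trace_mul_doorGap_of_antisymm (A : Matrix ι ι ℝ) (hA : Aᵀ = A) (d : ι → ℝ) (d' : τ → ℝ) (L : Matrix τ ι ℝ) (H : Matrix τ τ ℝ) (hH : Hᵀ = -H) :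
    Matrix.trace (A * ((Matrix.diagonal d * (Lᵀ * H * L) - (Lᵀ * H * L) * Matrix.diagonal d) - Lᵀ * (Matrix.diagonal d' * H - H * Matrix.diagonal d') * L))
      = 2 * Matrix.trace (H * (L * A * (L * Matrix.diagonal d - Matrix.diagonal d' * L)ᵀ)) := by
  rw [trace_mul_doorGap]
  have hT : ((L * Matrix.diagonal d - Matrix.diagonal d' * L) * A * Lᵀ) = (L * A * (L * Matrix.diagonal d - Matrix.diagonal d' * L)ᵀ)ᵀ := by
    rw [Matrix.transpose_mul, Matrix.transpose_mul, Matrix.transpose_transpose, hA, Matrix.mul_assoc]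
  rw [hT]
  exact trace_mul_sub_transpose_of_antisymm H _ hH

/-! ## §3 The cyclic mechanism: a commutator door traced against the inverse of the table it turns vanishes -/

omit [Fintype τ] [DecidableEq τ] [Fintype υ] [DecidableEq υ] in
/-- [folklore] **`trace_mul_commutator_eq_zero_of_inverse`**: if `B·A = 1` then `tr(A·(E·B − B·E)) = 0` for EVERY `E` — `tr(A·E·B) = tr(B·A·E) = tr E = tr(A·B·E)` (`A·B = 1`
by `mul_eq_one_comm`).  The kernel form of SPEC-64 §3 (B1)'s candidate mechanism («the propagator's Ward identity»): relevant exactly insofar as the table the door turns is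
the one the propagator inverts; nothing claimed about the record. -/
theorem trace_mul_commutator_eq_zero_of_inverse (A B E : Matrix ι ι ℝ) (hBA : B * A = 1) :
    Matrix.trace (A * (E * B - B * E)) = 0 := by
  have hAB : A * B = 1 := mul_eq_one_comm.mp hBA
  rw [Matrix.mul_sub, Matrix.trace_sub, ← Matrix.mul_assoc, ← Matrix.mul_assoc, hAB, Matrix.one_mul, Matrix.trace_mul_cycle, hBA, Matrix.one_mul, sub_self]

/-! ## §4 The tadpole telescope: lower storeys transport the propagator -/

/-- [folklore] **`trace_mul_doorGap_comp` — THE DOOR TADPOLE TELESCOPES WITH TRANSPORTED PROPAGATORS**: for legs `L̂₁ : Matrix τ ι ℝ`, `L̂₂ : Matrix υ τ ℝ`, a storey-2 brick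
`H : Matrix υ υ ℝ`, generators `E₀ E₁ E₂` and any `A : Matrix ι ι ℝ`:
`tr(A·gap(L̂₂L̂₁; E₀,E₂; H)) = tr(A·gap(L̂₁; E₀,E₁; L̂₂ᵀHL̂₂)) + tr((L̂₁·A·L̂₁ᵀ)·gap(L̂₂; E₁,E₂; H))` — the storey-2 gap is traced against `A` TRANSPORTED by the storey-1 legs
(PART 38 `doorGap_comp` + cyclicity; SPEC-64 (B1) second half ∕ (B2)'s frame; iterate for any depth). -/
theorem trace_mul_doorGap_comp (A : Matrix ι ι ℝ) (d₀ : ι → ℝ) (d₁ : τ → ℝ) (d₂ : υ → ℝ) (L₁ : Matrix τ ι ℝ) (L₂ : Matrix υ τ ℝ) (H : Matrix υ υ ℝ) :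
    Matrix.trace (A * ((Matrix.diagonal d₀ * ((L₂ * L₁)ᵀ * H * (L₂ * L₁)) - ((L₂ * L₁)ᵀ * H * (L₂ * L₁)) * Matrix.diagonal d₀)
        - (L₂ * L₁)ᵀ * (Matrix.diagonal d₂ * H - H * Matrix.diagonal d₂) * (L₂ * L₁)))
      = Matrix.trace (A * ((Matrix.diagonal d₀ * (L₁ᵀ * (L₂ᵀ * H * L₂) * L₁) - (L₁ᵀ * (L₂ᵀ * H * L₂) * L₁) * Matrix.diagonal d₀)
            - L₁ᵀ * (Matrix.diagonal d₁ * (L₂ᵀ * H * L₂) - (L₂ᵀ * H * L₂) * Matrix.diagonal d₁) * L₁))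
        + Matrix.trace ((L₁ * A * L₁ᵀ) * ((Matrix.diagonal d₁ * (L₂ᵀ * H * L₂) - (L₂ᵀ * H * L₂) * Matrix.diagonal d₁)
            - L₂ᵀ * (Matrix.diagonal d₂ * H - H * Matrix.diagonal d₂) * L₂)) := by
  rw [doorGap_comp d₀ d₁ d₂, Matrix.mul_add, Matrix.trace_add, trace_mul_mul₃_comm A L₁ᵀ L₁ _, Matrix.trace_mul_comm (L₁ * A * L₁ᵀ)]

end Summit.QuantumFields.BalabanUV.Beta.FP.TowerK2bDoorGapTadpole

end
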